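import Summits.Ventures.PercRepro.Graph

/-!
# Clusters described by closed boundaries (generic)

Set-level forms of the closed-cut lemma `mem_of_conn_of_closed_boundary` of `Graph`: a vertex set
`X` with no open edge across its boundary CONTAINS the cluster of each of its members
(`cluster_subset_of_closed_boundary`), IS that cluster when every member is connected to the
vertex (`cluster_eq_of_closed_boundary`), separates its members from its non-members
(`not_conn_of_closed_boundary`), and the cluster of a vertex with no open edge is the singleton
(`cluster_eq_singleton_of_isolated`).  Nothing here depends on a gadget: these are the four steps
by which an explicit candidate set (one per mark) is shown to be the open cluster of the mark.
-/

namespace PercRepro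

namespace MultiGraph

variable {V E : Type*} {G : MultiGraph V E}

/-- A set with a closed boundary contains the cluster of each of its members. -/
theorem cluster_subset_of_closed_boundary {ω : Config E} {X : Set V}
    (hX : ∀ e, ω e = true → (G.fst e ∈ X ↔ G.snd e ∈ X)) {v : V} (hv : v ∈ X) :
    G.cluster ω v ⊆ X :=
  fun _ hu => mem_of_conn_of_closed_boundary hX hv hu

/-- A set with a closed boundary whose members are all connected to `v ∈ X` is the cluster of `v`. -/
theorem cluster_eq_of_closed_boundary {ω : Config E} {X : Set V}
    (hX : ∀ e, ω e = true → (G.fst e ∈ X ↔ G.snd e ∈ X)) {v : V} (hv : v ∈ X)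
    (hconn : ∀ u ∈ X, G.Conn ω v u) : G.cluster ω v = X :=
  Set.Subset.antisymm (cluster_subset_of_closed_boundary hX hv)
    (fun u hu => (G.mem_cluster).2 (hconn u hu))

/-- A set with a closed boundary separates its members from its non-members. -/
theorem not_conn_of_closed_boundary {ω : Config E} {X : Set V}
    (hX : ∀ e, ω e = true → (G.fst e ∈ X ↔ G.snd e ∈ X)) {u v : V} (hu : u ∈ X) (hv : v ∉ X) :
    ¬ G.Conn ω u v :=
  fun h => hv (mem_of_conn_of_closed_boundary hX hu h)

/-- The cluster of a vertex with no open edge is the singleton. -/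
theorem cluster_eq_singleton_of_isolated {ω : Config E} {v : V}
    (hv : ∀ e, ω e = true → G.fst e ≠ v ∧ G.snd e ≠ v) : G.cluster ω v = {v} := by
  ext u
  rw [G.mem_cluster, Set.mem_singleton_iff]
  exact ⟨fun h => eq_of_conn_of_isolated hv h, fun h => h ▸ Conn.refl G ω v⟩

end MultiGraph

end PercRepro
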